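import Summits.HodgeConjecture.HodgeConjecture.Theorems.K2E3OrbitClosureHermitianCompression
import Summits.HodgeConjecture.HodgeConjecture.Theorems.K2E3OrbitClosureFlagBasis
import HarnessLib

/-!
# K2 ∕ E3 «EllipticInputs», unit U12 — helper file for socket #10 `sig_K2E3OrbitClosureContainsSemisimple`:
# GRADED BASES for an isometry of a non-degenerate hermitian space (the non-split half of [HarishChandra1999, §21 p. 87])

Cell `hodgecm-mathlib` (Track B «K2-LIT»), item h413 = `stmt-HodgeConjecture-24833`; author K2E3-p10 (g0).  PROOF lane (theorems
only, no `sorry`).  For `h : V →ₛₗ[σ] V →ₗ[K] K` hermitian (`σ` an involution) and non-degenerate over a field with `2 ≠ 0`, and an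
isometry `g`, `exists_graded_basis` produces a basis `b`, integer levels `e` and a SEMISIMPLE `s` with
(i) `h(b_k, b_l) = 0` unless `e_k + e_l = 0` (so the cocharacter `b_l ↦ u^{e_l} b_l`, `σ u = u`, is an isometry),
(ii) `(g b_l)_k = 0` for `e_k < e_l` (block upper-triangular), (iii) `s` = the level-diagonal part of `g`.
Induction on `dim V` along a MINIMAL `g`-stable subspace `W` (★ `K2E3OrbitClosureFlagBasis`): `W ⊓ W^⊥` is `g`-stable, hence `⊥`
(`step_nondegenerate`: `V = W ⊕ W^⊥`, level `0` on `W`) or `W` (`step_isotropic`: hyperbolic frame `W ⊕ U ⊕ W'` of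
★ `K2E3OrbitClosureHermitianPairs` ∕ ★ `…HermitianCompression`, levels `M ∕ e_U ∕ −M`, the `W'`-block `((A^σ)ᵀ)⁻¹` being semisimple with
`A = g|_W`).  No Jordan decomposition and no structure theory of unitary groups is used.

References: [HarishChandra1999] Harish-Chandra (DeBacker–Sally), *Admissible invariant distributions on reductive p-adic groups*, AMS ULS 16
(1999), §21 p. 87; J. Dieudonné, *La géométrie des groupes classiques* (1971), Ch. I §11.
-/

set_option autoImplicit false
set_option linter.dupNamespace false

namespace Summit.HodgeConjecture.HodgeConjecture.Cruxes.H413.K2E3OrbitClosureHermitianGradedBasis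

open Module Module.End K2E3OrbitClosureHermitianPairs K2E3OrbitClosureHermitianCompression K2E3OrbitClosureFlagBasis
open scoped Matrix

variable {K : Type*} [Field K] {σ : K →+* K} {V : Type*} [AddCommGroup V] [Module K V] [FiniteDimensional K V]
  (h : V →ₛₗ[σ] V →ₗ[K] K)

/-! ## §1 The two induction steps -/

/-- **Non-degenerate step**: if the minimal `g`-stable `W` has `W ⊓ W^⊥ = ⊥`, then `V = W ⊕ W^⊥` and graded bases of
`(W^⊥, g|_{W^⊥})` extend by `W` at level `0`. [folklore] -/
theorem step_nondegenerate (hherm : ∀ x y, h y x = σ (h x y)) (hnd : ∀ x, (∀ y, h x y = 0) → x = 0)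
    {g : Module.End K V} (hg : ∀ x y, h (g x) (g y) = h x y) (hginj : Function.Injective g)
    {W : Submodule K V} (hW : W ∈ g.invtSubmodule) (ha : Module.End.IsSemisimple (g.restrict hW)) (hWne : W ≠ ⊥)
    (hbot : W ⊓ W.orthogonalBilin h = ⊥)
    (ih : ∀ U : Submodule K V, finrank K U < finrank K V → (∀ x : U, (∀ y : U, h x y = 0) → x = 0) →
      ∀ gU : Module.End K U, (∀ x y : U, h (gU x) (gU y) = h x y) →
        ∃ (ι : Type) (_ : Fintype ι) (b : Basis ι K U) (e : ι → ℤ) (s : Module.End K U),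
          (∀ k l, e k + e l ≠ 0 → h (b k) (b l) = 0) ∧ (∀ k l, e k < e l → b.repr (gU (b l)) k = 0) ∧
          (∀ k l, b.repr (s (b l)) k = if e k = e l then b.repr (gU (b l)) k else 0) ∧ s.IsSemisimple) :
    ∃ (ι : Type) (_ : Fintype ι) (b : Basis ι K V) (e : ι → ℤ) (s : Module.End K V),
      (∀ k l, e k + e l ≠ 0 → h (b k) (b l) = 0) ∧ (∀ k l, e k < e l → b.repr (g (b l)) k = 0) ∧
      (∀ k l, b.repr (s (b l)) k = if e k = e l then b.repr (g (b l)) k else 0) ∧ s.IsSemisimple := by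
  classical
  set C := W.orthogonalBilin h with hCdef
  have hgW : W.map g = W := map_eq_of_mem_invtSubmodule hginj hW
  have hCinv : C ∈ g.invtSubmodule := orthogonalBilin_mem_invtSubmodule h hg hgW
  have hWC : IsCompl W C := isCompl_orthogonalBilin_of_disjoint h (disjoint_iff.2 hbot)
  have hCdim : finrank K C < finrank K V := by
    have h1 := Submodule.finrank_add_eq_of_isCompl hWC
    have h2 : finrank K W ≠ 0 := fun h0 => hWne (Submodule.finrank_eq_zero.1 h0)
    omega
  have hndC : ∀ x : C, (∀ y : C, h x y = 0) → x = 0 :=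
    nondegenerate_restrict_orthogonalBilin h hherm hnd hWC.sup_eq_top
  let gC : Module.End K C := g.restrict hCinv
  have hgCcoe : ∀ c : C, (gC c : V) = g c := fun _ => rfl
  have hgCiso : ∀ x y : C, h (gC x) (gC y) = h x y := fun x y => by rw [hgCcoe, hgCcoe, hg]
  obtain ⟨ιC, _instC, bC, eC, sC, hC0, hC1, hC2, hC3⟩ := ih C hCdim hndC gC hgCiso
  -- assembling the basis
  let bW := Module.finBasis K W
  set prC : V →ₗ[K] C := C.projectionOnto W hWC.symm with hprC
  set prW : V →ₗ[K] W := W.projectionOnto C hWC with hprW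
  set E : (W × C) ≃ₗ[K] V := W.prodEquivOfIsCompl C hWC with hEdef
  let b : Basis (Fin (finrank K W) ⊕ ιC) K V := (bW.prod bC).map E
  let e : Fin (finrank K W) ⊕ ιC → ℤ := Sum.elim (fun _ => 0) eC
  let a : Module.End K W := g.restrict hW
  let s : Module.End K V := E.toLinearMap ∘ₗ (a.prodMap sC) ∘ₗ E.symm.toLinearMap
  have hEsymm : ∀ v, E.symm v = (prW v, prC v) := fun v => Submodule.prodEquivOfIsCompl_symm_apply hWC v
  have hrepr_inl : ∀ v i, b.repr v (Sum.inl i) = bW.repr (prW v) i := by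
    intro v i
    simp only [b, Basis.map_repr, LinearEquiv.trans_apply, hEsymm, Basis.prod_repr_inl]
  have hrepr_inr : ∀ v j, b.repr v (Sum.inr j) = bC.repr (prC v) j := by
    intro v j
    simp only [b, Basis.map_repr, LinearEquiv.trans_apply, hEsymm, Basis.prod_repr_inr]
  have hb_inl : ∀ i, b (Sum.inl i) = (bW i : V) := by
    intro i; simp [b, hEdef]
  have hb_inr : ∀ j, b (Sum.inr j) = (bC j : V) := by
    intro j; simp [b, hEdef]
  have hprW_W : ∀ w : W, prW w = w := fun w => Submodule.projectionOnto_apply_left hWC w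
  have hprC_W : ∀ w : W, prC w = 0 := fun w => Submodule.projectionOnto_apply_right hWC.symm w
  have hprW_C : ∀ c : C, prW c = 0 := fun c => Submodule.projectionOnto_apply_right hWC c
  have hprC_C : ∀ c : C, prC c = c := fun c => Submodule.projectionOnto_apply_left hWC.symm c
  have hgWmem : ∀ i, g (bW i : V) ∈ W := fun i => hW (bW i).2
  have hprC_gW : ∀ i, prC (g (bW i : V)) = 0 := fun i =>
    (Submodule.projectionOnto_apply_eq_zero_iff hWC.symm).2 (hgWmem i)
  have hEapply : ∀ x : W × C, E x = (x.1 : V) + (x.2 : V) := fun x => rfl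
  have hs_inl : ∀ i, s (b (Sum.inl i)) = g (bW i : V) := by
    intro i
    rw [hb_inl]
    simp only [s, LinearMap.comp_apply, LinearEquiv.coe_toLinearMap, hEsymm, hprW_W, hprC_W, LinearMap.prodMap_apply,
      map_zero, hEapply, Submodule.coe_zero, add_zero]
    rfl
  have hs_inr : ∀ j, s (b (Sum.inr j)) = (sC (bC j) : V) := by
    intro j
    rw [hb_inr]
    simp only [s, LinearMap.comp_apply, LinearEquiv.coe_toLinearMap, hEsymm, hprW_C, hprC_C, LinearMap.prodMap_apply,
      map_zero, hEapply, Submodule.coe_zero, zero_add]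
  refine ⟨Fin (finrank K W) ⊕ ιC, inferInstance, b, e, s, ?_, ?_, ?_, ?_⟩
  · rintro (i | j) (i' | j') hne
    · simp [e] at hne
    · rw [hb_inl, hb_inr]; exact (bC j').2 _ (bW i).2
    · rw [hb_inr, hb_inl, apply_eq_zero_comm h hherm]; exact (bC j).2 _ (bW i').2
    · rw [hb_inr, hb_inr]; exact hC0 j j' (by simpa [e] using hne)
  · rintro (i | j) (i' | j') hlt
    · simp [e] at hlt
    · rw [hb_inr, hrepr_inl, ← hgCcoe, hprW_C, map_zero, Finsupp.zero_apply]
    · rw [hb_inl, hrepr_inr, hprC_gW, map_zero, Finsupp.zero_apply]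
    · rw [hb_inr, hrepr_inr, ← hgCcoe, hprC_C]
      exact hC1 j j' (by simpa [e] using hlt)
  · rintro (i | j) (i' | j')
    · have he : e (Sum.inl i) = e (Sum.inl i') := rfl
      rw [if_pos he, hs_inl, hb_inl]
    · rw [hs_inr, hb_inr, hrepr_inl, hrepr_inl, hprW_C, ← hgCcoe, hprW_C, map_zero, Finsupp.zero_apply]
      split_ifs <;> rfl
    · rw [hs_inl, hb_inl, hrepr_inr, hprC_gW, map_zero, Finsupp.zero_apply]
      split_ifs <;> rfl
    · rw [hs_inr, hb_inr, hrepr_inr, hrepr_inr, hprC_C, ← hgCcoe, hprC_C, hC2 j j']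
      simp [e]
  · refine (LinearEquiv.isSemisimple_iff (a.prodMap sC) s E ?_).1 (isSemisimple_prodMap ha hC3)
    apply LinearMap.ext
    intro x
    simp [s]

/-- **Totally isotropic step**: if the minimal `g`-stable `W` is totally isotropic, take hyperbolic partners `W'`, `U = (W ⊕ W')^⊥`,
graded bases of `(U, g_U)` by induction, and levels `M ∕ e_U ∕ −M`; the level-diagonal part is `g|_W ⊕ s_U ⊕ d` with
`d = ((A^σ)ᵀ)⁻¹` the `W'`-block. [folklore] -/
theorem step_isotropic (hσ : ∀ a, σ (σ a) = a) (h2 : (2 : K) ≠ 0) (hherm : ∀ x y, h y x = σ (h x y))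
    (hnd : ∀ x, (∀ y, h x y = 0) → x = 0)
    {g : Module.End K V} (hg : ∀ x y, h (g x) (g y) = h x y) (hginj : Function.Injective g)
    {W : Submodule K V} (hW : W ∈ g.invtSubmodule) (ha : Module.End.IsSemisimple (g.restrict hW)) (hWne : W ≠ ⊥)
    (hle : W ≤ W.orthogonalBilin h)
    (ih : ∀ U : Submodule K V, finrank K U < finrank K V → (∀ x : U, (∀ y : U, h x y = 0) → x = 0) →
      ∀ gU : Module.End K U, (∀ x y : U, h (gU x) (gU y) = h x y) →
        ∃ (ι : Type) (_ : Fintype ι) (b : Basis ι K U) (e : ι → ℤ) (s : Module.End K U),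
          (∀ k l, e k + e l ≠ 0 → h (b k) (b l) = 0) ∧ (∀ k l, e k < e l → b.repr (gU (b l)) k = 0) ∧
          (∀ k l, b.repr (s (b l)) k = if e k = e l then b.repr (gU (b l)) k else 0) ∧ s.IsSemisimple) :
    ∃ (ι : Type) (_ : Fintype ι) (b : Basis ι K V) (e : ι → ℤ) (s : Module.End K V),
      (∀ k l, e k + e l ≠ 0 → h (b k) (b l) = 0) ∧ (∀ k l, e k < e l → b.repr (g (b l)) k = 0) ∧
      (∀ k l, b.repr (s (b l)) k = if e k = e l then b.repr (g (b l)) k else 0) ∧ s.IsSemisimple := by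
  classical
  have hWiso : ∀ x ∈ W, ∀ y ∈ W, h x y = 0 := fun x hx y hy => hle hy x hx
  have hgW : W.map g = W := map_eq_of_mem_invtSubmodule hginj hW
  let bW := Module.finBasis K W
  have hr : 0 < finrank K W := Nat.pos_of_ne_zero fun h0 => hWne (Submodule.finrank_eq_zero.1 h0)
  obtain ⟨w', hww', hw'w'⟩ := exists_hyperbolic_partner h hσ h2 hherm hnd hWiso bW
  -- the common orthogonal `U` of the frame
  let U : Submodule K V := ⨅ i, LinearMap.ker (h (bW i : V)) ⊓ LinearMap.ker (h (w' i))
  have hU : ∀ v, v ∈ U ↔ (∀ i, h (bW i) v = 0) ∧ ∀ i, h (w' i) v = 0 := by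
    intro v
    simp only [U, Submodule.mem_iInf, Submodule.mem_inf, LinearMap.mem_ker]
    exact ⟨fun H => ⟨fun i => (H i).1, fun i => (H i).2⟩, fun H i => ⟨H.1 i, H.2 i⟩⟩
  have hww : ∀ i j, h (bW i) (bW j) = 0 := fun i j => hWiso _ (bW i).2 _ (bW j).2
  have hwu : ∀ i (u : U), h (bW i) u = 0 := fun i u => ((hU u).1 u.2).1 i
  have hw'u : ∀ i (u : U), h (w' i) u = 0 := fun i u => ((hU u).1 u.2).2 i
  -- the compression and the induction hypothesis on `U`
  obtain ⟨gU, hgUcoe, hgUiso⟩ := exists_compression h hherm hg hgW hWiso bW w' hww' hU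
  have hUdim : finrank K U < finrank K V := finrank_lt_of_frame h bW w' hww' hU ⟨0, hr⟩
  have hndU : ∀ x : U, (∀ y : U, h x y = 0) → x = 0 := nondegenerate_restrict h hherm hWiso bW w' hww' hw'w' hU hnd
  obtain ⟨ιU, _instU, bU, eU, sU, hU0, hU1, hU2, hU3⟩ := ih U hUdim hndU gU hgUiso
  obtain ⟨b, hb_inl, hb_inm, hb_inr, hc_inl, hc_inr, -, -⟩ :=
    exists_adapted_basis h hherm hWiso bW w' hww' hw'w' hU bU
  -- levels
  set M : ℤ := (∑ j, |eU j|) + 1 with hMdef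
  have hMabs : ∀ j, |eU j| < M := fun j => by
    have h1 : |eU j| ≤ ∑ i, |eU i| := Finset.single_le_sum (fun i _ => abs_nonneg (eU i)) (Finset.mem_univ j)
    omega
  have hM1 : ∀ j, eU j < M := fun j => (le_abs_self _).trans_lt (hMabs j)
  have hM2 : ∀ j, -M < eU j := fun j => by have := neg_abs_le (eU j); have := hMabs j; omega
  have hM0 : 0 < M := by
    have : 0 ≤ ∑ i, |eU i| := Finset.sum_nonneg fun i _ => abs_nonneg (eU i)
    omega
  let e : Fin (finrank K W) ⊕ (ιU ⊕ Fin (finrank K W)) → ℤ := Sum.elim (fun _ => M) (Sum.elim eU fun _ => -M)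
  -- the level-diagonal part
  let dvec : Fin (finrank K W) → V := fun l => ∑ l', h (bW l') (g (w' l)) • w' l'
  let s : Module.End K V :=
    b.constr K (Sum.elim (fun i => g (bW i : V)) (Sum.elim (fun j => (sU (bU j) : V)) dvec))
  have hs_inl : ∀ i, s (b (Sum.inl i)) = g (bW i : V) := fun i => by
    simp only [s, Basis.constr_basis, Sum.elim_inl]
  have hs_inm : ∀ j, s (b (Sum.inr (Sum.inl j))) = (sU (bU j) : V) := fun j => by
    simp only [s, Basis.constr_basis, Sum.elim_inr, Sum.elim_inl]
  have hs_inr : ∀ l, s (b (Sum.inr (Sum.inr l))) = dvec l := fun l => by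
    simp only [s, Basis.constr_basis, Sum.elim_inr]
  -- coordinates
  have FW : ∀ (w : W) (x : ιU ⊕ Fin (finrank K W)), b.repr (w : V) (Sum.inr x) = 0 := by
    intro w x
    rw [coe_eq_sum_repr bW w]
    simp only [← hb_inl]
    rw [repr_sum_inl]
    rfl
  have FgW : ∀ i (x : ιU ⊕ Fin (finrank K W)), b.repr (g (bW i : V)) (Sum.inr x) = 0 := fun i x =>
    FW ⟨g (bW i : V), hW (bW i).2⟩ x
  have FU : ∀ (u : U) j, b.repr (u : V) (Sum.inr (Sum.inl j)) = bU.repr u j := by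
    intro u j
    rw [coe_eq_sum_repr bU u]
    simp only [← hb_inm]
    rw [repr_sum_inr_inl]
    rfl
  have FU_inl : ∀ (u : U) i, b.repr (u : V) (Sum.inl i) = 0 := fun u i => by rw [hc_inl]; exact hw'u i u
  have FU_inr : ∀ (u : U) i, b.repr (u : V) (Sum.inr (Sum.inr i)) = 0 := fun u i => by rw [hc_inr]; exact hwu i u
  have Fg_mid : ∀ (u : U) j, b.repr (g u) (Sum.inr (Sum.inl j)) = bU.repr (gU u) j := by
    intro u j
    have hgu : g (u : V) = (gU u : V) + ∑ i, h (w' i) (g u) • (bW i : V) := by rw [hgUcoe]; abel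
    rw [hgu, map_add, Finsupp.add_apply, FU]
    simp only [← hb_inl]
    rw [repr_sum_inl]
    simp
  have Fg_inr : ∀ (u : U) i, b.repr (g u) (Sum.inr (Sum.inr i)) = 0 := fun u i => by
    rw [hc_inr]; exact apply_w_g_eq_zero h hg hgW bW w' hU i u
  have Fd : ∀ l k, b.repr (dvec l) k =
      Sum.elim (fun _ => (0 : K)) (Sum.elim (fun _ => (0 : K)) fun l' => h (bW l') (g (w' l))) k := by
    intro l k
    simp only [dvec, ← hb_inr]
    exact repr_sum_inr_inr b _ k
  refine ⟨Fin (finrank K W) ⊕ (ιU ⊕ Fin (finrank K W)), inferInstance, b, e, s, ?_, ?_, ?_, ?_⟩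
  · -- (i) graded orthogonality
    rintro (i | j | l) (i' | j' | l') hne
    · rw [hb_inl, hb_inl]; exact hww i i'
    · rw [hb_inl, hb_inm]; exact hwu i (bU j')
    · simp [e] at hne
    · rw [hb_inm, hb_inl, apply_eq_zero_comm h hherm]; exact hwu i' (bU j)
    · rw [hb_inm, hb_inm]; exact hU0 j j' (by simpa [e] using hne)
    · rw [hb_inm, hb_inr, apply_eq_zero_comm h hherm]; exact hw'u l' (bU j)
    · simp [e] at hne
    · rw [hb_inr, hb_inm]; exact hw'u l (bU j')
    · rw [hb_inr, hb_inr]; exact hw'w' l l'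
  · -- (ii) block upper-triangularity
    rintro (i | j | l) (i' | j' | l') hlt
    · simp [e] at hlt
    · exact absurd hlt (by simpa [e] using (hM1 j').le)
    · exfalso; simp [e] at hlt; omega
    · rw [hb_inl]; exact FgW i' (Sum.inl j)
    · rw [hb_inm, Fg_mid]; exact hU1 j j' (by simpa [e] using hlt)
    · exfalso; simp [e] at hlt; linarith [hM2 j]
    · rw [hb_inl]; exact FgW i' (Sum.inr l)
    · rw [hb_inm]; exact Fg_inr (bU j') l
    · simp [e] at hlt
  · -- (iii) the level-diagonal part
    rintro (i | j | l) (i' | j' | l')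
    · have he : e (Sum.inl i) = e (Sum.inl i') := rfl
      rw [if_pos he, hs_inl, hb_inl]
    · rw [hs_inm, FU_inl, if_neg (show ¬ e (Sum.inl i) = e (Sum.inr (Sum.inl j')) by simpa [e] using (hM1 j').ne')]
    · rw [hs_inr, Fd, if_neg (show ¬ e (Sum.inl i) = e (Sum.inr (Sum.inr l')) by simp [e]; omega)]
      rfl
    · rw [hs_inl, hb_inl, FgW]
      split_ifs <;> rfl
    · rw [hs_inm, hb_inm, FU, Fg_mid, hU2 j j']
      simp [e]
    · rw [hs_inr, Fd, if_neg (show ¬ e (Sum.inr (Sum.inl j)) = e (Sum.inr (Sum.inr l')) by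
        simp [e]; linarith [hM2 j])]
      rfl
    · rw [hs_inl, hb_inl, FgW]
      split_ifs <;> rfl
    · rw [hs_inm, hb_inm, FU_inr, Fg_inr]
      split_ifs <;> rfl
    · have he : e (Sum.inr (Sum.inr l)) = e (Sum.inr (Sum.inr l')) := rfl
      rw [if_pos he, hs_inr, hb_inr, Fd, hc_inr]
      rfl
  · -- (iv) semisimplicity: `s` preserves `W`, `U`, `W' = span w'` and is semisimple on each
    let W' : Submodule K V := Submodule.span K (Set.range w')
    let N : Fin (finrank K W) ⊕ (ιU ⊕ Fin (finrank K W)) → Submodule K V :=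
      Sum.elim (fun _ => W) (Sum.elim (fun _ => U) fun _ => W')
    have hdvec_mem : ∀ l, dvec l ∈ W' := fun l =>
      Submodule.sum_mem _ fun l' _ => Submodule.smul_mem _ _ (Submodule.subset_span ⟨l', rfl⟩)
    have hsW : W ∈ s.invtSubmodule := by
      rw [Module.End.mem_invtSubmodule_iff_forall_mem_of_mem]
      intro w hw
      rw [show w = ((⟨w, hw⟩ : W) : V) from rfl, coe_eq_sum_repr bW ⟨w, hw⟩, map_sum]
      exact Submodule.sum_mem _ fun i _ => by
        rw [map_smul, ← hb_inl, hs_inl]; exact Submodule.smul_mem _ _ (hW (bW i).2)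
    have hsU : U ∈ s.invtSubmodule := by
      rw [Module.End.mem_invtSubmodule_iff_forall_mem_of_mem]
      intro u hu
      rw [show u = ((⟨u, hu⟩ : U) : V) from rfl, coe_eq_sum_repr bU ⟨u, hu⟩, map_sum]
      exact Submodule.sum_mem _ fun j _ => by
        rw [map_smul, ← hb_inm, hs_inm]; exact Submodule.smul_mem _ _ (sU (bU j)).2
    have hsW' : W' ∈ s.invtSubmodule := by
      rw [Module.End.mem_invtSubmodule_iff_forall_mem_of_mem]
      intro x hx
      obtain ⟨c, rfl⟩ := (Submodule.mem_span_range_iff_exists_fun K).1 hx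
      rw [map_sum]
      exact Submodule.sum_mem _ fun l _ => by
        rw [map_smul, ← hb_inr, hs_inr]; exact Submodule.smul_mem _ _ (hdvec_mem l)
    have hN : ∀ k, N k ∈ s.invtSubmodule := by
      rintro (i | j | l)
      · exact hsW
      · exact hsU
      · exact hsW'
    have htop : ⨆ k, N k = ⊤ := by
      rw [eq_top_iff, ← b.span_eq, Submodule.span_le]
      rintro _ ⟨k, rfl⟩
      refine Submodule.mem_iSup_of_mem k ?_
      rcases k with i | j | l
      · change b (Sum.inl i) ∈ W
        rw [hb_inl]; exact (bW i).2
      · change b (Sum.inr (Sum.inl j)) ∈ U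
        rw [hb_inm]; exact (bU j).2
      · change b (Sum.inr (Sum.inr l)) ∈ W'
        rw [hb_inr]; exact Submodule.subset_span ⟨l, rfl⟩
    refine K2E3OrbitClosureSemisimpleTransport.isSemisimple_of_iSup_eq_top s N hN htop ?_
    rintro (i | j | l)
    · -- on `W`, `s = g`
      change Module.End.IsSemisimple (s.restrict hsW)
      have hsg : s.restrict hsW = g.restrict hW := bW.ext fun i' => Subtype.ext (by
        change s (bW i' : V) = g (bW i' : V)
        have := hs_inl i'
        rwa [hb_inl] at this)
      rw [hsg]; exact ha
    · -- on `U`, `s = s_U`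
      have hsUr : ∀ x ∈ U, s x ∈ U := hsU
      change Module.End.IsSemisimple (s.restrict hsUr)
      have hsU' : s.restrict hsUr = sU := bU.ext fun j' => Subtype.ext (by
        change s (bU j' : V) = (sU (bU j') : V)
        have := hs_inm j'
        rwa [hb_inm] at this)
      rw [hsU']; exact hU3
    · -- on `W'`, the matrix of `s` in the basis `w'` is the `W'`-block `D`
      have hsW'r : ∀ x ∈ W', s x ∈ W' := hsW'
      change Module.End.IsSemisimple (s.restrict hsW'r)
      have hli : LinearIndependent K w' := by
        have := b.linearIndependent.comp (fun l => Sum.inr (Sum.inr l)) (Sum.inr_injective.comp Sum.inr_injective)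
        convert this using 1
        funext l
        simp [hb_inr]
      let bW' : Basis (Fin (finrank K W)) K W' := Basis.span hli
      have hbW' : ∀ l, (bW' l : V) = w' l := fun l => congrArg Subtype.val (Basis.span_apply hli l)
      set D : Matrix (Fin (finrank K W)) (Fin (finrank K W)) K := Matrix.of fun l' l => h (bW l') (g (w' l)) with hDdef
      have hD : Module.End.IsSemisimple (Matrix.toLin' D) := isSemisimple_wBlock h hg bW w' hww' hσ hW ha
      refine (LinearEquiv.isSemisimple_iff (s.restrict hsW'r) (Matrix.toLin' D) bW'.equivFun ?_).2 hD
      refine bW'.ext fun l₀ => ?_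
      have hsl : s.restrict hsW'r (bW' l₀) = ∑ l', D l' l₀ • bW' l' := by
        apply Subtype.ext
        have h1 : (s.restrict hsW'r (bW' l₀) : V) = s (w' l₀) := by rw [LinearMap.coe_restrict_apply, hbW']
        rw [h1, Submodule.coe_sum]
        have h2 := hs_inr l₀
        rw [hb_inr] at h2
        rw [h2]
        refine Finset.sum_congr rfl fun l' _ => ?_
        rw [Submodule.coe_smul, hbW', hDdef, Matrix.of_apply]
      change bW'.equivFun (s.restrict hsW'r (bW' l₀)) = Matrix.toLin' D (bW'.equivFun (bW' l₀))
      rw [hsl, Matrix.toLin'_apply]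
      funext l'
      rw [Basis.equivFun_apply, bW'.repr_sum_self, Matrix.mulVec, dotProduct]
      simp only [Basis.equivFun_self, mul_ite, mul_one, mul_zero, Finset.sum_ite_eq, Finset.mem_univ, if_true]

/-! ## §2 Graded bases -/

/-- **Graded bases for isometries of non-degenerate hermitian spaces** (induction on the dimension). [folklore] -/
theorem exists_graded_basis_aux {K : Type*} [Field K] {σ : K →+* K} (hσ : ∀ a, σ (σ a) = a) (h2 : (2 : K) ≠ 0) (n : ℕ) :
    ∀ (V : Type*) [AddCommGroup V] [Module K V] [FiniteDimensional K V], finrank K V = n →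
      ∀ (h : V →ₛₗ[σ] V →ₗ[K] K), (∀ x y, h y x = σ (h x y)) → (∀ x, (∀ y, h x y = 0) → x = 0) →
        ∀ g : Module.End K V, (∀ x y, h (g x) (g y) = h x y) →
          ∃ (ι : Type) (_ : Fintype ι) (b : Basis ι K V) (e : ι → ℤ) (s : Module.End K V),
            (∀ k l, e k + e l ≠ 0 → h (b k) (b l) = 0) ∧ (∀ k l, e k < e l → b.repr (g (b l)) k = 0) ∧
            (∀ k l, b.repr (s (b l)) k = if e k = e l then b.repr (g (b l)) k else 0) ∧ s.IsSemisimple := by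
  induction n using Nat.strong_induction_on with
  | _ n ih =>
  intro V _ _ _ hn h hherm hnd g hg
  classical
  have hginj : Function.Injective g := by
    intro x y hxy
    rw [← sub_eq_zero]
    refine hnd _ fun v => ?_
    rw [← hg, map_sub, hxy, sub_self, map_zero, LinearMap.zero_apply]
  rcases subsingleton_or_nontrivial V with hV | hV
  · exact ⟨PEmpty, inferInstance, Basis.empty V, fun _ => 0, 0, fun k => k.elim, fun k => k.elim, fun k => k.elim,
      Module.End.isSemisimple_zero⟩
  obtain ⟨W, hW, hWne, hWmin⟩ := exists_minimal_invtSubmodule g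
  have hgW : W.map g = W := map_eq_of_mem_invtSubmodule hginj hW
  have hWo : W.orthogonalBilin h ∈ g.invtSubmodule := orthogonalBilin_mem_invtSubmodule h hg hgW
  have ha : Module.End.IsSemisimple (g.restrict hW) := isSemisimple_restrict_of_minimal g hW hWmin
  have ih' : ∀ U : Submodule K V, finrank K U < finrank K V → (∀ x : U, (∀ y : U, h x y = 0) → x = 0) →
      ∀ gU : Module.End K U, (∀ x y : U, h (gU x) (gU y) = h x y) →
        ∃ (ι : Type) (_ : Fintype ι) (b : Basis ι K U) (e : ι → ℤ) (s : Module.End K U),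
          (∀ k l, e k + e l ≠ 0 → h (b k) (b l) = 0) ∧ (∀ k l, e k < e l → b.repr (gU (b l)) k = 0) ∧
          (∀ k l, b.repr (s (b l)) k = if e k = e l then b.repr (gU (b l)) k else 0) ∧ s.IsSemisimple :=
    fun U hU hndU gU hgU => ih _ (hn ▸ hU) U rfl (h.domRestrict₁₂ U U) (fun x y => hherm x y) hndU gU hgU
  rcases hWmin (W ⊓ W.orthogonalBilin h) (Module.End.invtSubmodule.inf_mem hW hWo) inf_le_left with hbot | htot
  · exact step_nondegenerate h hherm hnd hg hginj hW ha hWne hbot ih'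
  · exact step_isotropic h hσ h2 hherm hnd hg hginj hW ha hWne (inf_eq_left.1 htot) ih'

/-- **Graded bases** (packaged): for an isometry `g` of a finite-dimensional non-degenerate hermitian space `(V, h)` over a field
with `2 ≠ 0` (`σ` an involution) there are a basis `b`, levels `e : ι → ℤ` and a semisimple `s` with `h(b_k, b_l) = 0` unless
`e_k + e_l = 0`, `(g b_l)_k = 0` for `e_k < e_l`, and `s` the level-diagonal part of `g`. [cite: HarishChandra1999, §21 p. 87] -/
theorem exists_graded_basis (hσ : ∀ a, σ (σ a) = a) (h2 : (2 : K) ≠ 0) (hherm : ∀ x y, h y x = σ (h x y))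
    (hnd : ∀ x, (∀ y, h x y = 0) → x = 0) (g : Module.End K V) (hg : ∀ x y, h (g x) (g y) = h x y) :
    ∃ (ι : Type) (_ : Fintype ι) (b : Basis ι K V) (e : ι → ℤ) (s : Module.End K V),
      (∀ k l, e k + e l ≠ 0 → h (b k) (b l) = 0) ∧ (∀ k l, e k < e l → b.repr (g (b l)) k = 0) ∧
      (∀ k l, b.repr (s (b l)) k = if e k = e l then b.repr (g (b l)) k else 0) ∧ s.IsSemisimple :=
  exists_graded_basis_aux hσ h2 (finrank K V) V rfl h hherm hnd g hg

end Summit.HodgeConjecture.HodgeConjecture.Cruxes.H413.K2E3OrbitClosureHermitianGradedBasis
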